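/-
Copyright (c) 2026 the pub-hodgecm-mathlib formalisation cell (harness21).  Prover seat hodgecm-mathlib-LH4-p07 (g8), req620 Track A «(D-RAM) FOUR-FRAME» squad
(STAGE-1b pre-scoping, heir LEAD F0P3a-plan (g20∕g21) T19-24 clause; dealer LH4-plan (g12∕g13) WORD #36 «p07 (g8): row-(2) lead»), 2026-09-04.
-/
import Summits.HodgeConjecture.HodgeConjecture.Theorems.F0P3cDyRamToricLevelCensusRamMTwoMult   -- ★ p858876∕p858944 (LH4-p04 (g6)): `v_twist_sub_twist_eq` (type-free guard letter for the pair `(μ∕c, μν∕c′)`)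
import HarnessLib

/-!
# Crux `H413`, line LH4 «(D-RAM) FOUR-FRAME» — STAGE-1b, row (2): (C1-P^{a,b}) GUARD LETTER «THE TWO-MULTIPLIER GUARD OF THE JOINT PROFILE CENSUS IN γ'S TOKENS»
# `|ρμ₁∕μ₁ − ρμ₂∕μ₂| = |ν − ρν| ∕ |ν|`,  `μ₁ = (lam − jE u)∕jE c`, `μ₂ = ((lam − 1)² − jE (u − 1)²)∕jE c′ = μ₁·ν·(jE c∕jE c′)`, `ν := lam + jE u − 2`

Cell `hodgecm-mathlib` (D-0151), FLOOR 0, crux item H413 = `stmt-HodgeConjecture-24833`, route of record `HCCMUnconditional`; squad F0∕P3c∕LH4; lane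
`--supports stmt-HodgeConjecture-24833 --as helper` (count-neutral; pays NO tier-0 row).  THEOREMS ONLY (no `def`, no instance, no notation, no `sorry`).  Type-free field algebra
(`K` valued, `ρ : K →+* K` isometric; `jE : E →+* K` with `ρ`-fixed image).

THE POINT.  The guarded joint profile censuses ★ p859278 (M∕E unramified) ∕ ★ p859305 (M∕E ramified) of the template pieces `lev_{a,m}` carry the lattice-free guard
`j + b ≤ m_deep ∨ |ρμ₁∕μ₁ − ρμ₂∕μ₂| ≤ exp(…)` for the depth multiplier `μ₁ = (jE c)⁻¹(lam − jE u)` and the square multiplier `μ₂ = (jE c′)⁻¹((lam − 1)² − jE (u − 1)²)`.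
Since `(lam − 1)² − (jE u − 1)² = (lam − jE u)·(lam + jE u − 2)`, the square multiplier is `μ₁·ν·(jE c∕jE c′)` with `ν := lam + jE u − 2`, and LH4-p04 (g6)'s ★ `v_twist_sub_twist_eq` reads
the guard in `γ`'s tokens: `|ρμ₁∕μ₁ − ρμ₂∕μ₂| = |ν − ρν| ∕ |ν|` — the `ρ`-TWIST DEPTH of `ν = lam + jE u − 2` (a letter of the element `Γ = endoGL (γ₂, u)`: `lam` the line multiplier,
`u` the middle entry), independent of the conductors `c, c′` and of the lattice.  Likewise `|μ₂| = |μ₁|·|ν|·|jE c|∕|jE c′|` sorts which multiplier is the shallower.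
* `sub_one_sq_sub_map_sub_one_sq` (the factorisation), `sq_multiplier_eq` (`μ₂ = μ₁·ν·(jE c∕jE c′)` in the census's token shape), `v_sq_multiplier_eq` (values),
  `v_twist_depth_sub_twist_sq_eq` (THE GUARD LETTER, stated on the census's literal tokens so that `rw` applies inside ★ p859278 ∕ ★ p859305).
HONEST LABEL.  Count-neutral algebra; nothing printed is asserted; no census law is stated; `HC_CM` is proved only modulo the 7 printed citations (2 remaining named inputs:
hLiu418 = `stmt-HodgeConjecture-24832`, h413 = `stmt-HodgeConjecture-24833`) until rung 0 closes.

## References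
* [Kottwitz1986BaseChangeUnits] R. E. Kottwitz, *Base change for unit elements of Hecke algebras*, Compositio Math. 60 (1986): §1 pp. 240–241.
* [Serre1979] J.-P. Serre, *Local Fields*, GTM 67 (1979): Ch. II §1 (the ultrametric inequality).
* [Flicker1998UnitaryFL] Y. Z. Flicker, *Elementary proof of the fundamental lemma for a unitary group*, Canad. J. Math. 50 (1998): Prop. 7 p. 84.
-/

set_option autoImplicit false

noncomputable section

open scoped Valued WithZero
open WithZero
open Summit.HodgeConjecture.HodgeConjecture.Cruxes.H413.F0P3cDyRamToricLevelCensusRamMTwoMult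

namespace Summit.HodgeConjecture.HodgeConjecture.Cruxes.H413.F0P3cDyRamJointProfileCensusGuardLetter

-- `K : Type` (not `Type*`): ★ `…RamMTwoMult` is stated in universe `0`.
variable {E : Type*} {K : Type} [Field E] [Field K] [Valued K ℤᵐ⁰] {ρ : K →+* K}

omit [Valued K ℤᵐ⁰] in
/-- The factorisation behind the square token: `(lam − 1)² − jE (u − 1)² = (lam − jE u)·(lam + jE u − 2)`. [cite: Flicker1998UnitaryFL, Prop. 7 p. 84] -/
theorem sub_one_sq_sub_map_sub_one_sq (jE : E →+* K) (lam : K) (u : E) :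
    (lam - 1) * (lam - 1) - jE ((u - 1) ^ 2) = (lam - jE u) * (lam + jE u - 2) := by
  rw [map_pow, map_sub, map_one]; ring

omit [Valued K ℤᵐ⁰] in
/-- **THE SQUARE MULTIPLIER IS THE DEPTH MULTIPLIER TIMES `ν·(jE c∕jE c′)`** (in the literal token shape of ★ p859229 ∕ p859278 ∕ p859305; `jE c ≠ 0`):
`(jE c′)⁻¹((lam − 1)² − jE (u − 1)²) = ((jE c)⁻¹(lam − jE u))·(lam + jE u − 2)·(jE c·(jE c′)⁻¹)`. [cite: Kottwitz1986BaseChangeUnits, §1 pp. 240–241] -/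
theorem sq_multiplier_eq (jE : E →+* K) (lam : K) (u : E) {c : E} (hc : jE c ≠ 0) (c' : E) :
    (jE c')⁻¹ * ((lam - 1) * (lam - 1) - jE ((u - 1) ^ 2)) = (jE c)⁻¹ * (lam - jE u) * (lam + jE u - 2) * (jE c * (jE c')⁻¹) := by
  rw [sub_one_sq_sub_map_sub_one_sq]
  field_simp

/-- **VALUES**: `|μ₂| = |μ₁|·|ν|·(|jE c|∕|jE c′|)` — sorts the shallower multiplier of the guarded censuses. [cite: Serre1979, Ch. II §1] -/
theorem v_sq_multiplier_eq (jE : E →+* K) (lam : K) (u : E) {c : E} (hc : jE c ≠ 0) (c' : E) :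
    Valued.v ((jE c')⁻¹ * ((lam - 1) * (lam - 1) - jE ((u - 1) ^ 2))) =
      Valued.v ((jE c)⁻¹ * (lam - jE u)) * Valued.v (lam + jE u - 2) * (Valued.v (jE c) / Valued.v (jE c')) := by
  simp only [sq_multiplier_eq jE lam u hc c', map_mul, map_inv₀, div_eq_mul_inv]

/-- **THE GUARD LETTER (type-free).**  For `ρ` isometric with `ρ (jE c) = jE c`, `ρ (jE c′) = jE c′`, `jE c, jE c′ ≠ 0`, `lam ≠ jE u`, `ν := lam + jE u − 2 ≠ 0`:
`|ρμ₁∕μ₁ − ρμ₂∕μ₂| = |ν − ρν| ∕ |ν|` for `μ₁ = (jE c)⁻¹(lam − jE u)`, `μ₂ = (jE c′)⁻¹((lam − 1)² − jE (u − 1)²)` — ★ (LH4-p04) `v_twist_sub_twist_eq` at `(μ, ν, c, c′) :=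
(lam − jE u, lam + jE u − 2, jE c, jE c′)`, the tokens rewritten into the census's literal shape. [cite: Kottwitz1986BaseChangeUnits, §1 pp. 240–241] [cite: Serre1979, Ch. II §1] -/
theorem v_twist_depth_sub_twist_sq_eq (hvρ : ∀ x, Valued.v (ρ x) = Valued.v x) (jE : E →+* K) {lam : K} {u c c' : E}
    (hc : jE c ≠ 0) (hc' : jE c' ≠ 0) (hρc : ρ (jE c) = jE c) (hρc' : ρ (jE c') = jE c') (hμ : lam - jE u ≠ 0) (hν : lam + jE u - 2 ≠ 0) :
    Valued.v (ρ ((jE c)⁻¹ * (lam - jE u)) / ((jE c)⁻¹ * (lam - jE u)) -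
        ρ ((jE c')⁻¹ * ((lam - 1) * (lam - 1) - jE ((u - 1) ^ 2))) / ((jE c')⁻¹ * ((lam - 1) * (lam - 1) - jE ((u - 1) ^ 2)))) =
      Valued.v ((lam + jE u - 2) - ρ (lam + jE u - 2)) / Valued.v (lam + jE u - 2) := by
  have h1 : (jE c)⁻¹ * (lam - jE u) = (lam - jE u) / jE c := by rw [inv_mul_eq_div]
  have h2 : (jE c')⁻¹ * ((lam - 1) * (lam - 1) - jE ((u - 1) ^ 2)) = (lam - jE u) * (lam + jE u - 2) / jE c' := by
    rw [sub_one_sq_sub_map_sub_one_sq, inv_mul_eq_div]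
  rw [h1, h2]
  exact v_twist_sub_twist_eq hvρ hμ hν hc hc' hρc hρc'

end Summit.HodgeConjecture.HodgeConjecture.Cruxes.H413.F0P3cDyRamJointProfileCensusGuardLetter

end
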